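import Mathlib.RingTheory.PowerSeries.Evaluation
import Mathlib.RingTheory.PowerSeries.PiTopology
import Mathlib.RingTheory.MvPowerSeries.LinearTopology
import Mathlib.Topology.Algebra.LinearTopology
import Literature.NumberTheory.GaloisRepresentations.PadicAlgClFiniteSubextensionDvr
import Literature.NumberTheory.ComplexMultiplication.EllipticUnits.RubinMainConjecture
import HarnessLib

/-!
# Route `SignedLowerHalves`, crux L `SmallImageLowerHalfBothSigns` (stmt-BirchSwinnertonDyer-23599), line `rtt_w3` v14 → v15 — E2, row «D-tw-alg» (LEAD):
# THE TWIST AUTOMORPHISM `σ = Tw_η` OF `Λ_{𝒪,2} = 𝒪⟦T₂⟧⟦T₁⟧`, `σ(T_i) = u_i(1+T_i) − 1` (`u_i ∈ 1 + 𝔪_𝒪`)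

WHY (RULING «U»; honda g23 «D-tw-coh» 2c: `twistHom_X_smul : Tw (X • x) = (C (C u₁) * (1 + X) − 1) • Tw x`, `twistHom_C_X_smul`,
`twistHom_C_C_smul`, `u_i = θ(γ_i)θ*(γ_i)⁻¹ = η(γ_i)⁻¹`). The consumers (p784139 / p784278) take a ring automorphism `σ : R ≃+* R` along which the Iwasawa-level
twist `Tw : 𝐇^i(χ₀) ≃+ 𝐇^i(θ*)` is semilinear. Since `u_i − 1 ∈ 𝔪 ∖ {0}`, `σ` is an ANALYTIC substitution (constant term of `σ(T_i)` is not nilpotent): we build it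
with Mathlib's topological evaluation `PowerSeries.aeval` in the pi topology. §1 (any complete Hausdorff linearly topologised `A`): ★★ `exists_ringEquiv_twist` —
for a unit `v` with `v − 1` topologically nilpotent, a continuous ring automorphism `τ` of `A⟦T⟧` with `τ T = v(1+T) − 1`, `τ⁻¹ T = v⁻¹(1+T) − 1`, constants fixed.
§2: `𝒪 = padicCoeffIntegers S` is complete (`[ℚ_p(S):ℚ_p] < ∞`) and linearly topologised; `‖v − 1‖ < 1 ⇒ v − 1` topologically nilpotent. §3 ★★★ `exists_twistRingEquiv`:
`σ : Λ_{𝒪,2} ≃+* Λ_{𝒪,2}` with `σ X = C (C u₁) * (1 + X) − 1`, `σ (C X) = C (C u₂ * (1 + X) − 1)`, `σ (C (C c)) = C (C c)`, and the inverse formulas — the inner twist on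
coefficients followed by the outer twist over `A' = 𝒪⟦T₂⟧` at the unit `C u₁`. ∃-forms only (no definitions).

THEOREMS ONLY (`--supports stmt-BirchSwinnertonDyer-23599` helper); closes nothing; crux L, crux M, E2 and BSD remain OPEN and are proved for NO curve by any of this.
[cite: Washington1997, §7.1, §13.2] [cite: NeukirchSchmidtWingberg2008, (5.3.5)] [cite: JohnsonLeungKings2011, §4.1 Def. 4.1, §4.2] [cite: BourbakiAC5to7, III §4.5]
-/

set_option autoImplicit false
set_option linter.dupNamespace false

noncomputable section

open PowerSeries Filter Literature.NumberTheory.EllipticCurves Literature.NumberTheory.ComplexMultiplication.EllipticUnits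
open scoped Topology PowerSeries.WithPiTopology MvPowerSeries.WithPiTopology

namespace Summit.BirchSwinnertonDyer.BirchSwinnertonDyer.Theorems.SmallImageRttD2Twist

section Generic

/-- `A⟦T⟧` is Hausdorff in the pi topology. [folklore] -/
theorem t2Space_powerSeries (A : Type*) [UniformSpace A] [T2Space A] : T2Space (PowerSeries A) := PowerSeries.WithPiTopology.instT2Space A
/-- `A⟦T⟧` is complete in the pi topology. [folklore] -/
theorem completeSpace_powerSeries (A : Type*) [UniformSpace A] [CompleteSpace A] : CompleteSpace (PowerSeries A) :=
  PowerSeries.WithPiTopology.instCompleteSpace A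
/-- `A⟦T⟧` is linearly topologised in the pi topology. [folklore] -/
theorem isLinearTopology_powerSeries (A : Type*) [CommRing A] [UniformSpace A] [IsLinearTopology A A] :
    IsLinearTopology (PowerSeries A) (PowerSeries A) :=
  inferInstanceAs (IsLinearTopology (MvPowerSeries Unit A) (MvPowerSeries Unit A))

/-- `v⁻¹ − 1 = −v⁻¹ (v − 1)` is topologically nilpotent with `v − 1`. [folklore] -/
theorem isTopologicallyNilpotent_inv_sub_one {A : Type*} [CommRing A] [TopologicalSpace A] [IsLinearTopology A A] (v : Aˣ)
    (hv : IsTopologicallyNilpotent ((v : A) - 1)) : IsTopologicallyNilpotent (((v⁻¹ : Aˣ) : A) - 1) := by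
  have h : ((v⁻¹ : Aˣ) : A) - 1 = (-((v⁻¹ : Aˣ) : A)) * ((v : A) - 1) := by
    rw [neg_mul, mul_sub, mul_one, Units.inv_mul, neg_sub]
  rw [h, IsTopologicallyNilpotent]
  simp_rw [mul_pow]
  exact IsLinearTopology.tendsto_mul_zero_of_right _ _ hv

variable {A : Type*} [CommRing A] [UniformSpace A] [IsUniformAddGroup A] [IsTopologicalRing A] [IsLinearTopology A A]
  [T2Space A] [CompleteSpace A]

omit [IsUniformAddGroup A] [T2Space A] [CompleteSpace A] in
/-- The twist point `v(1+T) − 1 = C (v − 1) + C v · T` is evaluable when `v − 1` is topologically nilpotent (docstring of `hasEval_twistPoint`). [folklore] -/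
theorem hasEval_twistPoint (v : A) (hv : IsTopologicallyNilpotent (v - 1)) :
    HasEval (C (v - 1) + C v * X : PowerSeries A) := by
  haveI : IsLinearTopology (PowerSeries A) (PowerSeries A) := isLinearTopology_powerSeries A
  refine HasEval.add ?_ (HasEval.mul_left _ HasEval.X)
  exact MvPowerSeries.LinearTopology.isTopologicallyNilpotent_of_constantCoeff (σ := Unit)
    (by rwa [show MvPowerSeries.constantCoeff (C (v - 1) : PowerSeries A) = v - 1 from constantCoeff_C _])

/-- ★★ **The twist automorphism `T ↦ v(1+T) − 1` of `A⟦T⟧`** for a unit `v` with `v − 1` topologically nilpotent (e.g. `v ∈ 1 + 𝔪` in a complete local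
ring): a continuous `A`-algebra automorphism with inverse `T ↦ v⁻¹(1+T) − 1`. (∃-form; in E2: `Tw_η` on each variable of `Λ_𝒪 = 𝒪⟦T₂⟧⟦T₁⟧`.)
[cite: Washington1997, §7.1, §13.2] [cite: NeukirchSchmidtWingberg2008, (5.3.5)] [folklore] -/
theorem exists_ringEquiv_twist (v : Aˣ) (hv : IsTopologicallyNilpotent ((v : A) - 1)) :
    ∃ τ : PowerSeries A ≃+* PowerSeries A,
      τ X = C ((v : A) - 1) + C (v : A) * X ∧ τ.symm X = C (((v⁻¹ : Aˣ) : A) - 1) + C ((v⁻¹ : Aˣ) : A) * X ∧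
      (∀ c : A, τ (C c) = C c) ∧ (∀ c : A, τ.symm (C c) = C c) ∧ Continuous τ := by
  haveI : T2Space (PowerSeries A) := t2Space_powerSeries A
  haveI : CompleteSpace (PowerSeries A) := completeSpace_powerSeries A
  haveI : IsLinearTopology (PowerSeries A) (PowerSeries A) := isLinearTopology_powerSeries A
  have ha := hasEval_twistPoint (v : A) hv
  have hb := hasEval_twistPoint ((v⁻¹ : Aˣ) : A) (isTopologicallyNilpotent_inv_sub_one v hv)
  -- `aeval` at `X`, and `aeval` at the point `X` is the identity
  have aeval_apply_X : ∀ {a : PowerSeries A} (ha : HasEval a), PowerSeries.aeval ha (X : PowerSeries A) = a := fun {a} ha ↦ by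
    have h : ((Polynomial.X : Polynomial A) : PowerSeries A) = X := Polynomial.coe_X
    rw [← h, aeval_coe, Polynomial.aeval_X]
  have aeval_eq_id : ∀ {a : PowerSeries A} (ha : HasEval a), a = X → PowerSeries.aeval ha = AlgHom.id A (PowerSeries A) := fun {a} ha h ↦ by
    have hε : Continuous ((AlgHom.id A (PowerSeries A) : PowerSeries A →ₐ[A] PowerSeries A) : PowerSeries A → PowerSeries A) :=
      continuous_id
    have key := aeval_unique hε
    convert key using 2
    rw [h]; rfl
  let τ₁ : PowerSeries A →ₐ[A] PowerSeries A := PowerSeries.aeval ha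
  let τ₂ : PowerSeries A →ₐ[A] PowerSeries A := PowerSeries.aeval hb
  have hτ₁X : τ₁ X = C ((v : A) - 1) + C (v : A) * X := aeval_apply_X ha
  have hτ₂X : τ₂ X = C (((v⁻¹ : Aˣ) : A) - 1) + C ((v⁻¹ : Aˣ) : A) * X := aeval_apply_X hb
  have hC : ∀ (τ : PowerSeries A →ₐ[A] PowerSeries A) (c : A), τ (C c) = C c := fun τ c ↦ τ.commutes c
  -- the two compositions are the identity
  have h21 : τ₂.comp τ₁ = AlgHom.id A (PowerSeries A) := by
    rw [comp_aeval ha (continuous_aeval hb)]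
    refine aeval_eq_id _ ?_
    change τ₂ (C ((v : A) - 1) + C (v : A) * X) = X
    rw [map_add, map_mul, hC, hC, hτ₂X, mul_add, ← mul_assoc, ← map_mul, ← map_mul, Units.mul_inv, map_one, one_mul, ← add_assoc,
      ← map_add]
    have h0 : (v : A) - 1 + (v : A) * (((v⁻¹ : Aˣ) : A) - 1) = 0 := by rw [mul_sub, mul_one, Units.mul_inv]; ring
    rw [h0, map_zero, zero_add]
  have h12 : τ₁.comp τ₂ = AlgHom.id A (PowerSeries A) := by
    rw [comp_aeval hb (continuous_aeval ha)]
    refine aeval_eq_id _ ?_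
    change τ₁ (C (((v⁻¹ : Aˣ) : A) - 1) + C ((v⁻¹ : Aˣ) : A) * X) = X
    rw [map_add, map_mul, hC, hC, hτ₁X, mul_add, ← mul_assoc, ← map_mul, ← map_mul, Units.inv_mul, map_one, one_mul, ← add_assoc,
      ← map_add]
    have h0 : ((v⁻¹ : Aˣ) : A) - 1 + ((v⁻¹ : Aˣ) : A) * ((v : A) - 1) = 0 := by rw [mul_sub, mul_one, Units.inv_mul]; ring
    rw [h0, map_zero, zero_add]
  let e : PowerSeries A ≃ₐ[A] PowerSeries A := AlgEquiv.ofAlgHom τ₁ τ₂ h12 h21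
  exact ⟨e.toRingEquiv, hτ₁X, hτ₂X, fun c ↦ hC τ₁ c, fun c ↦ hC τ₂ c, continuous_aeval ha⟩

end Generic

/-! ## §2 The coefficient ring `𝒪 = padicCoeffIntegers S`: complete, linearly topologised -/

section Coeff

variable {p : ℕ} [Fact p.Prime] (S : Set (PadicAlgCl p))

/-- A closed subset of a complete set is complete. [folklore] -/
theorem isComplete_inter_of_isClosed {α : Type*} [UniformSpace α] {s t : Set α} (hs : IsComplete s) (ht : IsClosed t) :
    IsComplete (s ∩ t) := fun f cf hf ↦ by
  obtain ⟨x, hxs, hx⟩ := hs f cf (hf.trans (Filter.principal_mono.2 Set.inter_subset_left))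
  exact ⟨x, ⟨hxs, isClosed_iff_clusterPt.mp ht x
    (cf.1.mono (le_inf hx (hf.trans (Filter.principal_mono.2 Set.inter_subset_right))))⟩, hx⟩

/-- **`𝒪 = {x ∈ ℚ_p(S) : ‖x‖ ≤ 1}` is complete** when `[ℚ_p(S) : ℚ_p] < ∞` (`ℚ_p(S)` is complete and the unit ball is closed). [folklore] -/
theorem completeSpace_padicCoeffIntegers [FiniteDimensional ℚ_[p] (padicCoeffField S)] : CompleteSpace (padicCoeffIntegers S) := by
  haveI : CompleteSpace (padicCoeffField S) := Literature.NumberTheory.GaloisRepresentations.PadicAlgCl.completeSpace (padicCoeffField S)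
  have hK : IsComplete ((padicCoeffField S : Set (PadicAlgCl p))) := completeSpace_coe_iff_isComplete.mp ‹_›
  have hset : ((padicCoeffIntegers S : Set (PadicAlgCl p))) = (padicCoeffField S : Set (PadicAlgCl p)) ∩ Metric.closedBall 0 1 := by
    ext x
    rw [SetLike.mem_coe, mem_padicCoeffIntegers_iff, Set.mem_inter_iff, SetLike.mem_coe, Metric.mem_closedBall, dist_zero_right]
  have h := isComplete_inter_of_isClosed hK (Metric.isClosed_closedBall (x := (0 : PadicAlgCl p)) (ε := 1))
  rw [← hset] at h
  exact completeSpace_coe_iff_isComplete.mpr h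

/-- The ideals `{x ∈ 𝒪 : ‖x‖ < ε}` (`ε > 0`; ultrametric). [folklore] -/
theorem exists_ideal_ball {ε : ℝ} (hε : 0 < ε) :
    ∃ I : Ideal (padicCoeffIntegers S), (I : Set (padicCoeffIntegers S)) = {x : padicCoeffIntegers S | ‖(x : PadicAlgCl p)‖ < ε} := by
  refine ⟨{ carrier := {x : padicCoeffIntegers S | ‖(x : PadicAlgCl p)‖ < ε}
            add_mem' := fun {a b} ha hb ↦ ?_
            zero_mem' := by simpa using hε
            smul_mem' := fun c {x} hx ↦ ?_ }, rfl⟩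
  · simp only [Set.mem_setOf_eq, Subring.coe_add] at *
    exact (IsUltrametricDist.norm_add_le_max _ _).trans_lt (max_lt ha hb)
  · simp only [Set.mem_setOf_eq, smul_eq_mul, Subring.coe_mul, norm_mul] at *
    calc ‖(c : PadicAlgCl p)‖ * ‖(x : PadicAlgCl p)‖ ≤ 1 * ‖(x : PadicAlgCl p)‖ := by
          gcongr; exact ((mem_padicCoeffIntegers_iff S _).mp c.2).2
      _ < ε := by rw [one_mul]; exact hx

/-- **`𝒪` is linearly topologised** (the balls around `0` are ideals). [folklore] -/
theorem isLinearTopology_padicCoeffIntegers : IsLinearTopology (padicCoeffIntegers S) (padicCoeffIntegers S) := by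
  choose I hI using fun ε : {ε : ℝ // 0 < ε} ↦ exists_ideal_ball S ε.2
  refine IsLinearTopology.mk_of_hasBasis' (padicCoeffIntegers S) (ι := {ε : ℝ // 0 < ε})
    (S := Ideal (padicCoeffIntegers S)) (p := fun _ ↦ True) (s := I) ?_ (fun J r m h ↦ Ideal.mul_mem_left J r h)
  have hb := (Metric.nhds_basis_ball (x := (0 : padicCoeffIntegers S)))
  refine hb.to_hasBasis' (fun ε hε ↦ ⟨⟨ε, hε⟩, trivial, fun x hx ↦ ?_⟩) (fun ε _ ↦ ?_)
  · have hx' : x ∈ (I ⟨ε, hε⟩ : Set (padicCoeffIntegers S)) := hx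
    rw [hI] at hx'
    simpa [Metric.mem_ball, dist_zero_right] using hx'
  · refine Filter.mem_of_superset (hb.mem_of_mem ε.2) fun x hx ↦ ?_
    rw [hI]
    simpa [Metric.mem_ball, dist_zero_right] using hx

/-- Elements `v` of `𝒪` with `‖v − 1‖ < 1` (i.e. `v ∈ 1 + 𝔪`) have `v − 1` topologically nilpotent. [folklore] -/
theorem isTopologicallyNilpotent_of_norm_lt_one {x : padicCoeffIntegers S} (hx : ‖(x : PadicAlgCl p)‖ < 1) :
    IsTopologicallyNilpotent x := by
  rw [IsTopologicallyNilpotent, Metric.tendsto_atTop]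
  intro ε hε
  obtain ⟨n, hn⟩ := exists_pow_lt_of_lt_one hε hx
  refine ⟨n, fun m hm ↦ ?_⟩
  rw [dist_zero_right]
  change ‖((x ^ m : padicCoeffIntegers S) : PadicAlgCl p)‖ < ε
  rw [Subring.coe_pow, norm_pow]
  exact (pow_le_pow_of_le_one (norm_nonneg _) hx.le hm).trans_lt hn

end Coeff

/-! ## §3 The twist automorphism `σ = Tw_η` of `R = Λ_{𝒪,2} = 𝒪⟦T₂⟧⟦T₁⟧` -/

section TwoVar

variable {p : ℕ} [Fact p.Prime] (S : Set (PadicAlgCl p)) [FiniteDimensional ℚ_[p] (padicCoeffField S)]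

/-- A ring automorphism of the coefficients induces one of the power series ring (coefficientwise). [folklore] -/
theorem exists_ringEquiv_map {A : Type*} [CommRing A] (τ : A ≃+* A) :
    ∃ m : PowerSeries A ≃+* PowerSeries A, ∀ f, m f = PowerSeries.map τ.toRingHom f := by
  refine ⟨{ PowerSeries.map τ.toRingHom with
    invFun := PowerSeries.map τ.symm.toRingHom
    left_inv := fun f ↦ by
      change PowerSeries.map τ.symm.toRingHom (PowerSeries.map τ.toRingHom f) = f
      rw [← RingHom.comp_apply, ← PowerSeries.map_comp, show τ.symm.toRingHom.comp τ.toRingHom = RingHom.id A from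
        RingHom.ext fun a ↦ τ.symm_apply_apply a, PowerSeries.map_id, id]
    right_inv := fun f ↦ by
      change PowerSeries.map τ.toRingHom (PowerSeries.map τ.symm.toRingHom f) = f
      rw [← RingHom.comp_apply, ← PowerSeries.map_comp, show τ.toRingHom.comp τ.symm.toRingHom = RingHom.id A from
        RingHom.ext fun a ↦ τ.apply_symm_apply a, PowerSeries.map_id, id] }, fun f ↦ rfl⟩

/-- ★★★ **The twist automorphism `σ = Tw_η` of `Λ_{𝒪,2} = 𝒪⟦T₂⟧⟦T₁⟧`** for units `u₁, u₂ ∈ 1 + 𝔪_𝒪`: `σ(T₁) = u₁(1+T₁) − 1`, `σ(T₂) = u₂(1+T₂) − 1`, constants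
fixed (∃-form). In E2 (RULING «U», honda g23's `twistHom_X_smul` / `twistHom_C_X_smul` / `twistHom_C_C_smul`): `u_i = θ(γ_i) θ*(γ_i)⁻¹ = η(γ_i)⁻¹` and the Iwasawa-level
twist `Tw : 𝐇^i(χ₀) ≃+ 𝐇^i(θ*)` is `σ`-semilinear. [cite: Washington1997, §13.2] [cite: NeukirchSchmidtWingberg2008, (5.3.5)] [cite: JohnsonLeungKings2011, §4.1–§4.2] -/
theorem exists_twistRingEquiv (u₁ u₂ : (padicCoeffIntegers S)ˣ) (h₁ : ‖(((u₁ : padicCoeffIntegers S)) : PadicAlgCl p) - 1‖ < 1)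
    (h₂ : ‖(((u₂ : padicCoeffIntegers S)) : PadicAlgCl p) - 1‖ < 1) :
    ∃ σ : IwasawaAlgebraO₂ S ≃+* IwasawaAlgebraO₂ S,
      σ X = C (C (u₁ : padicCoeffIntegers S)) * (1 + X) - 1 ∧
      σ (C X) = C (C (u₂ : padicCoeffIntegers S) * (1 + X) - 1) ∧
      (∀ c : padicCoeffIntegers S, σ (C (C c)) = C (C c)) ∧
      σ.symm X = C (C ((u₁⁻¹ : (padicCoeffIntegers S)ˣ) : padicCoeffIntegers S)) * (1 + X) - 1 ∧
      σ.symm (C X) = C (C ((u₂⁻¹ : (padicCoeffIntegers S)ˣ) : padicCoeffIntegers S) * (1 + X) - 1) := by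
  haveI := completeSpace_padicCoeffIntegers S
  haveI := isLinearTopology_padicCoeffIntegers S
  -- the inner twist `τ₂ : 𝒪⟦T₂⟧ ≃ 𝒪⟦T₂⟧`
  have hv₂ : IsTopologicallyNilpotent ((u₂ : padicCoeffIntegers S) - 1) := by
    refine isTopologicallyNilpotent_of_norm_lt_one S ?_
    rwa [AddSubgroupClass.coe_sub, OneMemClass.coe_one]
  obtain ⟨τ₂, hτ₂X, hτ₂X', hτ₂C, hτ₂C', -⟩ := exists_ringEquiv_twist (A := padicCoeffIntegers S) u₂ hv₂
  haveI : T2Space (PowerSeries (padicCoeffIntegers S)) := t2Space_powerSeries _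
  haveI : CompleteSpace (PowerSeries (padicCoeffIntegers S)) := completeSpace_powerSeries _
  haveI : IsLinearTopology (PowerSeries (padicCoeffIntegers S)) (PowerSeries (padicCoeffIntegers S)) := isLinearTopology_powerSeries _
  obtain ⟨m₂, hm₂⟩ := exists_ringEquiv_map τ₂
  -- the outer twist over `A' = 𝒪⟦T₂⟧` at the unit `C u₁`
  have hv₁ : IsTopologicallyNilpotent ((((Units.map (C : padicCoeffIntegers S →+* PowerSeries (padicCoeffIntegers S)).toMonoidHom u₁ :
      (PowerSeries (padicCoeffIntegers S))ˣ) : PowerSeries (padicCoeffIntegers S))) - 1) := by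
    refine MvPowerSeries.LinearTopology.isTopologicallyNilpotent_of_constantCoeff (σ := Unit) ?_
    have h0 : MvPowerSeries.constantCoeff ((((Units.map (C : padicCoeffIntegers S →+* PowerSeries (padicCoeffIntegers S)).toMonoidHom u₁ :
        (PowerSeries (padicCoeffIntegers S))ˣ) : PowerSeries (padicCoeffIntegers S))) - 1) = (u₁ : padicCoeffIntegers S) - 1 := by
      rw [map_sub, map_one, Units.coe_map, RingHom.toMonoidHom_eq_coe, MonoidHom.coe_coe]
      exact congrArg (· - 1) (constantCoeff_C _)
    rw [h0]
    refine isTopologicallyNilpotent_of_norm_lt_one S ?_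
    rwa [AddSubgroupClass.coe_sub, OneMemClass.coe_one]
  obtain ⟨τ₁, hτ₁X, hτ₁X', hC₁, hC₁', -⟩ := exists_ringEquiv_twist (A := PowerSeries (padicCoeffIntegers S)) _ hv₁
  have hm₂' : ∀ f, m₂.symm f = PowerSeries.map τ₂.symm.toRingHom f := fun f ↦ by
    apply m₂.injective
    rw [RingEquiv.apply_symm_apply, hm₂, ← RingHom.comp_apply, ← PowerSeries.map_comp,
      show τ₂.toRingHom.comp τ₂.symm.toRingHom = RingHom.id _ from RingHom.ext fun a ↦ τ₂.apply_symm_apply a, PowerSeries.map_id, id]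
  have hu₁ : ((Units.map (C : padicCoeffIntegers S →+* PowerSeries (padicCoeffIntegers S)).toMonoidHom u₁ :
      (PowerSeries (padicCoeffIntegers S))ˣ) : PowerSeries (padicCoeffIntegers S)) = C (u₁ : padicCoeffIntegers S) := by
    rw [Units.coe_map, RingHom.toMonoidHom_eq_coe, MonoidHom.coe_coe]
  have hu₁' : (((Units.map (C : padicCoeffIntegers S →+* PowerSeries (padicCoeffIntegers S)).toMonoidHom u₁)⁻¹ :
      (PowerSeries (padicCoeffIntegers S))ˣ) : PowerSeries (padicCoeffIntegers S)) = C ((u₁⁻¹ : (padicCoeffIntegers S)ˣ) : padicCoeffIntegers S) := by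
    rw [Units.coe_map_inv, RingHom.toMonoidHom_eq_coe, MonoidHom.coe_coe]
  refine ⟨m₂.trans τ₁, ?_, ?_, ?_, ?_, ?_⟩
  · rw [RingEquiv.trans_apply, hm₂, map_X, hτ₁X, hu₁, map_sub, map_one]
    ring
  · rw [RingEquiv.trans_apply, hm₂, map_C, RingEquiv.toRingHom_eq_coe, RingHom.coe_coe, hτ₂X, hC₁, map_sub, map_one]
    congr 1
    ring
  · intro c
    rw [RingEquiv.trans_apply, hm₂, map_C, RingEquiv.toRingHom_eq_coe, RingHom.coe_coe, hτ₂C, hC₁]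
  · rw [RingEquiv.symm_trans_apply, hτ₁X', hm₂', map_add, map_mul, map_C, map_C, map_X, hu₁', RingEquiv.toRingHom_eq_coe, RingHom.coe_coe,
      map_sub, hτ₂C', map_one]
    simp only [map_sub, map_one]
    ring
  · rw [RingEquiv.symm_trans_apply, hC₁', hm₂', map_C, RingEquiv.toRingHom_eq_coe, RingHom.coe_coe, hτ₂X', map_sub, map_one]
    congr 1
    ring

end TwoVar


end Summit.BirchSwinnertonDyer.BirchSwinnertonDyer.Theorems.SmallImageRttD2Twist

end
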